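import Summits.QuantumFields.YangMills.Theorems.BalabanLadderROTKingLimitCrystallographicCircles
import Summits.QuantumFields.YangMills.Theorems.CheckerboardTrialitySigma3DenseUpgrade
import HarnessLib

/-!
# Crux `ROT` (stmt-QuantumFields-20042), stub `stub_kingLimit` — CRYSTALLOGRAPHIC EXCLUSION of the finite planar stabilisers
# `C_{4m}`, `m ≥ 2`: the residual of the registered stub is «no UV limit point has planar stabiliser EXACTLY `C₄`», equivalently
# «KING at ANY ONE non-lattice angle»

Helper file (`--supports stmt-QuantumFields-20042 --as helper`; seat `ymfull-r2d-prover-1`, R590-ym item (15)); third of a series after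
✓`Theorems/BalabanLadderROTKingLimitStabiliser.lean` (p783639: `KingLimit ⇔` no off-diagonal UV limit point has planar stabiliser
`(π/(2m))ℤ`, `m ≥ 1`) and ✓`Theorems/BalabanLadderROTKingLimitCyclotomic.lean` (p783996: `cos (π/(2m)) ∉ ℤ̄` for `m ≥ 2`, so the composite
rotation below has an irrational angle).  Line of record «King split», skeleton v4 (824d5540ff52cfd5), ONE registered stub
`stub_kingLimit : KingLimit`; road-independent (every announced re-typing of `ROT` consumes `KingLimit`).

THE THEOREM (`planeRot_invariant_of_signedPerm_of_cyclicAngle`, §6).  Let `S₁` be a one-field family with bounded densities off the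
diagonal (`OffDiagDensity`) whose arity-`n` part is invariant on King's class `KingClass n r₀` under the signed permutations of the axes
(`W(B₄)` — automatic for every off-diagonal UV limit point of lattice Yang–Mills under `MomentBounds6`,
✓`CheckerboardTrialityHyperoctahedral.signedPerm_invariant_of_offDiagLimitAlong`) and under ONE plane rotation `R₀₁(π/(2m))` with `m ≥ 2`.
Then it is invariant under `R₀₁(θ)` for EVERY `θ`.  Consequently (`stabiliser_univ_or_eq_zmultiples_pi_div_two`) the planar stabiliser of a
`W(B₄)`-invariant density-bounded family is EITHER everything OR EXACTLY the lattice group `(π/2)ℤ = C₄`; the registered stub is equivalent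
to «no UV limit point has planar stabiliser exactly `C₄`» (★ `kingLimit_iff_noC4Stabiliser`); and limit-point invariance at ANY single angle
`θ₀ ∉ (π/2)ℤ` — rational multiples of `π` such as `π/3`, `π/4` included, and `θ₀` may depend on the limit point — gives `KingLimit`
(★ `kingLimit_of_anyAngleLimit`) and hence the route decl `Theses.BalabanLadder.ROT` (`rot_of_anyAngleLimit`, via ✓`rot_of_kingLimit`).
This widens the tree's single-angle door ✓`rot_of_kingSingleLimit` / ✓`kingLimit_iff_kingSingle`, which needs `θ₀/(2π) ∉ ℚ` (King's
Pythagorean `arcsin (3/5)`), to EVERY non-lattice angle: a two-regularisation comparison with a lattice of ANY other planar point group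
(hexagonal `C₆`, octagonal quasi-lattice, …) would do.

PROOF (group theory + the tree's orbit continuity; no Yang–Mills input).
* §2 The composite `G = R₀₁(α) ≫ σ`, `σ : x ↦ (x₂, −x₁, x₀, x₃)` (a signed permutation of determinant `1`, `det_sigmaU` by a `4 × 4`
  determinant): it fixes the vector `(sin α, 1 − cos α, sin α, 0)` (`composite_apply_axis`) and `e₃`, and on the test vector `f = e₀ − e₂ ⊥`
  axis, `⟪G f, f⟫ = −(1 + cos α)` (`inner_composite_test`).
* §3 Frames (`exists_frame_of_unit`): every unit `v ⊥ e₃` is `Q e₂` for an isometry `Q` of determinant `1` fixing `e₃` (spherical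
  coordinates: a rotation of the `(x₀,x₂)`-plane written as a conjugate of `planeRot 0 ψ` by the swap `x₁ ↔ x₂`, then `planeRot 0 φ`;
  angles from ✓`Mopup.exists_cos_eq_and_sin_eq`).
* §4 ★ `exists_conj_planeRot_eq_composite`: for `α = π/(2m)`, `G = Q ∘ R₀₁(ω) ∘ Q⁻¹` with `Q e₂ = n` the unit axis (`Q⁻¹ G Q` fixes `e₂, e₃`
  and has determinant `1`, so it IS a `planeRot 0 ω`, ✓`Mopup.exists_eq_planeRot`), and `2 cos ω = ⟪G f, f⟫ = −1 − cos α`; hence `ω/(2π)`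
  is irrational (✓`irrational_div_pi_of_two_cos_eq_neg`: `cos (π/(2m))` is not an algebraic integer while `2 cos (rπ)` is).  Also exported:
  `n₃ = 0`, `n₀ = n₂ ≥ 0`, `n₂² ≥ 1/3`.
* §5 ★ `planeRot_mem_of_conjCircle` — TWO CIRCLES GENERATE THE COORDINATE CIRCLE: if a composition-and-inverse-closed class `P` of isometries
  contains the whole circle `Q R₀₁(b) Q⁻¹` (all rotations about `n`) and the flip `σ₀` of `e₀`, it contains every `R₀₁(θ)`.  The conjugate
  circle about `σ₀ n` moves `n` continuously (`continuous_planeRot_angle`) from `n` (`b = 0`, inner product `1`) to a vector with inner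
  product `2p² − 1 ≤ 2/9 − 1 < 0 ≤ n₂ = ⟪e₂, n⟫` (`b = π`, `p = ⟪σ₀ n, n⟫ = 1 − 2n₂² ∈ [0, 1/3]`), so by the INTERMEDIATE VALUE THEOREM some
  `C ∈ P` has `⟪C n, n⟫ = ⟪e₂, n⟫`; transitivity of the plane rotations on circles (`exists_planeRot_apply_eq`, transported by `Q`) gives
  `D ∈ P` about `n` with `D (C n) = e₂`; `k = C ≫ D ∈ P` maps `n ↦ e₂`, fixes `e₃`, `det k = 1` (`det_trans`, `det_conj`), so `Q ≫ k =
  planeRot 0 χ` and `R₀₁(θ) = k (Q R₀₁(θ) Q⁻¹) k⁻¹ ∈ P` (rotations of one plane commute, ✓`planeRot_add_apply`).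
* §6 Assembly: `G ∈` stabiliser; King's density step in the frame `Q` from the single irrational angle `ω`
  (✓`Sigma3.conj_planeRot_invariant_of_one_angle`) gives the circle about `n`; §5 gives every `R₀₁(θ)`; then the refined dichotomy with
  ✓`stabiliser_dichotomy`, and the two `KingLimit` criteria.

0 sorry, standard axioms, no definition (all objects are explicit terms or existential witnesses).  HONEST LABEL: structural reduction of the
registered stub; `KingLimit`, `ROT` and the Yang–Mills mass gap are NOT proved — the remaining content («the UV limit points of lattice
YM₄ have some planar symmetry beyond the quarter turns») is dynamical; `MomentBounds6` and the lattice symmetries supply `C₄` and nothing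
more (shape barrier ✓`ROT.exists_momentBoundsShape_not_angularWardShape`).

References: C. King, Commun. Math. Phys. 103 (1986) 323–349, Thm 2.4 (two-lattice comparison, the mechanism this widens); K. Osterwalder,
R. Schrader, CMP 31 (1973) §2; I. Niven, Irrational Numbers (1956) Ch. III §3; H. S. M. Coxeter, Regular Polytopes (1973) §3.7
(crystallographic restriction); J. H. Conway, N. J. A. Sloane, SPLAG (1999) Ch. 4 §7.1.
-/

set_option autoImplicit false

noncomputable section

open scoped SchwartzMap InnerProductSpace
open MeasureTheory Filter Topology
open Literature.MathematicalPhysics.QuantumFieldTheory Literature.MathematicalPhysics.QuantumLattice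
open Literature.MathematicalPhysics.AQFT Literature.Probability.LatticeModels
open Summit.QuantumFields.YangMills.Cruxes.OSLegsFromFemtoAndGap.DlrCollarTransfer
open Summit.QuantumFields.YangMills.Cruxes.OSLegsAtWeakCouplingC.Sketch
open Summit.QuantumFields.YangMills.Cruxes.OSLegsAtWeakCouplingC.Y2Bridge
open Summit.QuantumFields.YangMills.Theorems.NPointIsotropy.Negative (E4)
open Summit.QuantumFields.YangMills.Theorems.NPointIsotropy.ComplexRotationBandlimit.Mopup
  (exists_eq_planeRot exists_cos_eq_and_sin_eq)
open Summit.QuantumFields.YangMills.Theorems.CurvatureBoostCovariance.BoostsInheritMirrors.OrbitBandlimit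
  (planeRot_add_apply planeRot_symm_apply' det_planeRot)
open Literature.Analysis.FluidPDE (signedPermIsometry signedPermIsometry_apply isSignedPermIsometry_signedPermIsometry)

namespace Summit.QuantumFields.YangMills.Theorems.ROT.KingStabiliser
/-! ## §6 ★ The crystallographic exclusion and the refined residual of `stub_kingLimit` -/

/-- ★ **CRYSTALLOGRAPHIC EXCLUSION of `C_{4m}`, `m ≥ 2`.**  Let `S₁` be a one-field family with bounded densities off the diagonal whose
arity-`n` part is invariant on King's class `KingClass n r₀` under every signed permutation of the axes (`W(B₄)`; true for every
off-diagonal UV limit point of lattice Yang–Mills under `MomentBounds6`, ✓`signedPerm_invariant_of_offDiagLimitAlong`) AND under the plane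
rotation `R₀₁(π/(2m))` for some `m ≥ 2`.  Then it is invariant under `R₀₁(θ)` for EVERY angle `θ`.  Proof: the composite
`R₀₁(π/(2m)) ≫ σ` (`σ : x ↦ (x₂,−x₁,x₀,x₃)`) lies in the stabiliser and is a rotation by an angle `ω` with `2 cos ω = −1 − cos (π/(2m))`
about an axis `n` (`exists_conj_planeRot_eq_composite`); `ω/(2π) ∉ ℚ` because `cos (π/(2m))` is not an algebraic integer
(✓`not_isIntegral_cos_pi_div_two_mul`), so King's density step in the frame of `n` (✓`Sigma3.conj_planeRot_invariant_of_one_angle`) puts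
the whole circle of rotations about `n` in the stabiliser, and two circles generate the coordinate one (`planeRot_mem_of_conjCircle`).
So a finite planar symmetry group `C_{4m} ⊋ C₄` never occurs together with the cubic symmetry: the planar stabiliser of such a
family is `C₄` exactly or everything. [cite: King1986II, Thm 2.4 — mechanism] [cite: Niven1956, Ch. III §3] -/
theorem planeRot_invariant_of_signedPerm_of_cyclicAngle (S₁ : SchwingerFamily E4) (hdens : OffDiagDensity S₁) {n : ℕ}
    {r₀ : ℝ} (hW : ∀ F ∈ King.KingClass n r₀, ∀ R : E4 ≃ₗᵢ[ℝ] E4, IsSignedPerm R → S₁ n (linActMulti R F) = S₁ n F)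
    {m : ℕ} (hm : 2 ≤ m)
    (hα : ∀ F ∈ King.KingClass n r₀, S₁ n (linActMulti (planeRot (0 : Fin 3) (Real.pi / (2 * m))) F) = S₁ n F)
    (F : 𝓢((Fin n → E4), ℂ)) (hF : F ∈ King.KingClass n r₀) (θ : ℝ) :
    S₁ n (linActMulti (planeRot (0 : Fin 3) θ) F) = S₁ n F := by
  -- the stabiliser of the class
  let P : (E4 ≃ₗᵢ[ℝ] E4) → Prop := fun R => ∀ F ∈ King.KingClass n r₀, S₁ n (linActMulti R F) = S₁ n F
  have htrans : ∀ A B : E4 ≃ₗᵢ[ℝ] E4, P A → P B → P (A.trans B) := fun A B hA hB F hF => by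
    show S₁ n (linActMulti (A.trans B) F) = S₁ n F
    rw [Summit.QuantumFields.YangMills.Theorems.OSLegsFromFemtoAndGap.Upgrade.linActMulti_trans_eq,
      hB _ (King.linActMulti_mem_kingClass hF A), hA F hF]
  have hsymm : ∀ A : E4 ≃ₗᵢ[ℝ] E4, P A → P A.symm := fun A hA F hF => by
    show S₁ n (linActMulti A.symm F) = S₁ n F
    have h := hA _ (King.linActMulti_mem_kingClass hF A.symm)
    rw [linActMulti_linActMulti_symm] at h
    exact h.symm
  have hWP : ∀ R : E4 ≃ₗᵢ[ℝ] E4, IsSignedPerm R → P R := fun R hR F hF => hW F hF R hR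
  -- the composite and its structure
  obtain ⟨Q, ω, hQ3, hQdet, hn3, hn02, hn2, hn2sq, hGeq, -, hirr⟩ := exists_conj_planeRot_eq_composite hm
  have hGP : P ((planeRot (0 : Fin 3) (Real.pi / (2 * m))).trans
      (signedPermIsometry (Equiv.swap (0 : Fin 4) 2) (![1, -1, 1, 1] : Fin 4 → ℤˣ))) :=
    htrans _ _ (fun F hF => hα F hF) (hWP _ (isSignedPermIsometry_signedPermIsometry _ _))
  rw [hGeq] at hGP
  -- the full circle about the axis (King's density step in the frame `Q`, from the irrational angle `ω`)
  have hcirc : ∀ b : ℝ, P (Q.symm.trans ((planeRot (0 : Fin 3) b).trans Q)) := fun b F hF =>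
    Summit.QuantumFields.YangMills.Theorems.Sigma3.conj_planeRot_invariant_of_one_angle S₁ hdens Q hirr hGP F hF b
  -- two circles generate the coordinate circle
  exact planeRot_mem_of_conjCircle P htrans hsymm Q hQ3 hQdet hn3 hn02 hn2 hn2sq hcirc
    (hWP _ (isSignedPermIsometry_signedPermIsometry _ _)) θ F hF

/-- ★ **Refined stabiliser dichotomy: `C₄` exactly, or everything.**  For a one-field family with bounded densities off the diagonal that is
`W(B₄)`-invariant on King's class at radius `r₀` (all arities `≥ 2`), the planar stabiliser `{θ | ∀ n ≥ 2, ∀ F ∈ KingClass n r₀,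
S₁ n (R_θ F) = S₁ n F}` is EITHER all of `ℝ` OR exactly the lattice group `(π/2)ℤ` (✓`stabiliser_dichotomy` leaves `(π/(2m))ℤ`, `m ≥ 1`;
`planeRot_invariant_of_signedPerm_of_cyclicAngle` removes every `m ≥ 2`). [cite: King1986II, Thm 2.4 — mechanism] -/
theorem stabiliser_univ_or_eq_zmultiples_pi_div_two (S₁ : SchwingerFamily E4) (hdens : OffDiagDensity S₁) (r₀ : ℝ)
    (hW : ∀ n : ℕ, 2 ≤ n → ∀ F ∈ King.KingClass n r₀, ∀ R : E4 ≃ₗᵢ[ℝ] E4, IsSignedPerm R →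
      S₁ n (linActMulti R F) = S₁ n F) :
    (∀ (θ : ℝ) (n : ℕ), 2 ≤ n → ∀ F ∈ King.KingClass n r₀, S₁ n (linActMulti (planeRot (0 : Fin 3) θ) F) = S₁ n F) ∨
    {θ : ℝ | ∀ n : ℕ, 2 ≤ n → ∀ F ∈ King.KingClass n r₀, S₁ n (linActMulti (planeRot (0 : Fin 3) θ) F) = S₁ n F} =
      (AddSubgroup.zmultiples (Real.pi / 2) : Set ℝ) := by
  have hq : ∀ n : ℕ, 2 ≤ n → ∀ F ∈ King.KingClass n r₀,
      S₁ n (linActMulti (planeRot (0 : Fin 3) (Real.pi / 2)) F) = S₁ n F := fun n hn F hF =>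
    hW n hn F hF _ isSignedPerm_planeRot_pi_div_two
  rcases stabiliser_dichotomy S₁ hdens r₀ hq with h | ⟨m, hm, hEq⟩
  · exact Or.inl h
  · rcases Nat.lt_or_ge m 2 with hm1 | hm2
    · right
      have hm' : m = 1 := by omega
      rw [hEq, hm']
      norm_num
    · left
      have hmem : Real.pi / (2 * m) ∈ (AddSubgroup.zmultiples (Real.pi / (2 * m)) : Set ℝ) :=
        AddSubgroup.mem_zmultiples _
      rw [← hEq] at hmem
      intro θ n hn F hF
      exact planeRot_invariant_of_signedPerm_of_cyclicAngle S₁ hdens (fun F hF R hR => hW n hn F hF R hR) hm2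
        (fun F hF => hmem n hn F hF) F hF θ

/-- ★ **`KingLimit` ⇔ NO off-diagonal UV limit point has planar stabiliser EXACTLY the lattice group `C₄`.**  The registered stub
of crux `ROT` in its own quantifier prefix: `KingLimit` holds iff for every compact simple `G`, every `r`, every positive unit map `a → 0`
with `MomentBounds6 G r a` and every admissible scheme there is `r₀ > 0` such that no off-diagonal limit point along any subsequence has
planar stabiliser `(π/2)ℤ` on King's class at radius `r₀`.  (✓`kingLimit_iff_noCyclicStabiliser` asked to exclude every `(π/(2m))ℤ`; the
limit points are `W(B₄)`-invariant, so `m ≥ 2` is excluded for free.)  READING: the entire open content of `stub_kingLimit` is that the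
UV limit points of lattice Yang–Mills have SOME planar symmetry beyond the lattice's quarter turns — any one angle `θ ∉ (π/2)ℤ`, rational
or irrational multiple of `π` alike. [cite: King1986II, Thm 2.4 — mechanism] [cite: OS1973, §2] -/
theorem kingLimit_iff_noC4Stabiliser :
    KingLimit ↔
    ∀ (G : Type) [Group G] [TopologicalSpace G] [IsTopologicalGroup G] [CompactSpace G],
      IsCompactSimpleLieGroup G → letI : MeasurableSpace G := borel G; haveI : BorelSpace G := ⟨rfl⟩;
      ∀ (r : LatticeRep G) (a : ℝ → ℝ), (∀ β, 0 < a β) → Tendsto a atTop (𝓝 0) → MomentBounds6 G r a →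
        ∀ sch : SpeciesScheme (YMSpecies G), IsLegScheme a sch → ∃ r₀ : ℝ, 0 < r₀ ∧
          ∀ φ : ℕ → ℕ, Tendsto φ atTop atTop → ∀ S₁ : SchwingerFamily E4, OffDiagLimitAlong r sch φ S₁ →
            {θ : ℝ | ∀ n : ℕ, 2 ≤ n → ∀ F ∈ King.KingClass n r₀, S₁ n (linActMulti (planeRot (0 : Fin 3) θ) F) = S₁ n F} ≠
              (AddSubgroup.zmultiples (Real.pi / 2) : Set ℝ) := by
  constructor
  · intro hKL G _ _ _ _ hG
    letI : MeasurableSpace G := borel G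
    haveI : BorelSpace G := ⟨rfl⟩
    intro r a hapos ha0 hMB sch hsch
    obtain ⟨r₀, hr₀, H⟩ := kingLimit_iff_noCyclicStabiliser.1 hKL G hG r a hapos ha0 hMB sch hsch
    refine ⟨r₀, hr₀, fun φ hφ S₁ hS₁ => ?_⟩
    have h := H φ hφ S₁ hS₁ 1 le_rfl
    norm_num at h
    exact h
  · intro h G _ _ _ _ hG
    letI : MeasurableSpace G := borel G
    haveI : BorelSpace G := ⟨rfl⟩
    intro r a hapos ha0 hMB sch hsch
    obtain ⟨r₀, hr₀, H⟩ := h G hG r a hapos ha0 hMB sch hsch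
    refine ⟨r₀, hr₀, fun φ hφ S₁ hS₁ n hn F hF θ _ => ?_⟩
    have hW : ∀ n : ℕ, 2 ≤ n → ∀ F ∈ King.KingClass n r₀, ∀ R : E4 ≃ₗᵢ[ℝ] E4, IsSignedPerm R →
        S₁ n (linActMulti R F) = S₁ n F := fun n _ F hF R hR =>
      Summit.QuantumFields.YangMills.Theorems.CheckerboardTrialityHyperoctahedral.signedPerm_invariant_of_offDiagLimitAlong
        r hapos ha0 hMB hsch hφ hS₁ R hR n F hF.1
    rcases stabiliser_univ_or_eq_zmultiples_pi_div_two S₁ hS₁.2.1 r₀ hW with hall | hEq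
    · exact hall θ n hn F hF
    · exact absurd hEq (H φ hφ S₁ hS₁)

/-- ★ **`KingLimit` from invariance at ANY ONE non-lattice angle.**  If every off-diagonal UV limit point (under `MomentBounds6`, along
every admissible scheme and subsequence) is invariant on King's class at radius `r₀` under the plane rotation by SOME angle
`θ₀ ∉ (π/2)ℤ` — possibly depending on the limit point, and possibly a RATIONAL multiple of `π` (e.g. `π/3` from a comparison with a
regularisation of hexagonal planar symmetry, or `π/4`) — then the registered stub `KingLimit` holds.  This widens the tree's single-angle
door ✓`rot_of_kingSingleLimit` (which needs `θ₀/(2π) ∉ ℚ`) to every non-lattice angle. [cite: King1986II, Thm 2.4 — mechanism] -/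
theorem kingLimit_of_anyAngleLimit
    (h : ∀ (G : Type) [Group G] [TopologicalSpace G] [IsTopologicalGroup G] [CompactSpace G],
      IsCompactSimpleLieGroup G → letI : MeasurableSpace G := borel G; haveI : BorelSpace G := ⟨rfl⟩;
      ∀ (r : LatticeRep G) (a : ℝ → ℝ), (∀ β, 0 < a β) → Tendsto a atTop (𝓝 0) → MomentBounds6 G r a →
        ∀ sch : SpeciesScheme (YMSpecies G), IsLegScheme a sch → ∃ r₀ : ℝ, 0 < r₀ ∧
          ∀ φ : ℕ → ℕ, Tendsto φ atTop atTop → ∀ S₁ : SchwingerFamily E4, OffDiagLimitAlong r sch φ S₁ →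
            ∃ θ₀ : ℝ, θ₀ ∉ AddSubgroup.zmultiples (Real.pi / 2) ∧
              ∀ (n : ℕ), 2 ≤ n → ∀ F ∈ King.KingClass n r₀, S₁ n (linActMulti (planeRot (0 : Fin 3) θ₀) F) = S₁ n F) :
    KingLimit := by
  refine kingLimit_iff_noC4Stabiliser.2 ?_
  intro G _ _ _ _ hG
  letI : MeasurableSpace G := borel G
  haveI : BorelSpace G := ⟨rfl⟩
  intro r a hapos ha0 hMB sch hsch
  obtain ⟨r₀, hr₀, H⟩ := h G hG r a hapos ha0 hMB sch hsch
  refine ⟨r₀, hr₀, fun φ hφ S₁ hS₁ hEq => ?_⟩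
  obtain ⟨θ₀, hθ₀, hinv⟩ := H φ hφ S₁ hS₁
  have hmem : θ₀ ∈ (AddSubgroup.zmultiples (Real.pi / 2) : Set ℝ) := by
    rw [← hEq]
    exact hinv
  exact hθ₀ hmem

/-- ★ **`ROT` from lattice KING… in limit form at any one non-lattice angle** — the rotation leg `Theses.BalabanLadder.ROT` follows from
limit-point invariance at one angle `θ₀ ∉ (π/2)ℤ` (by `kingLimit_of_anyAngleLimit` and the landed closer ✓`rot_of_kingLimit`).
[cite: King1986II, Thm 2.4 — mechanism] -/
theorem rot_of_anyAngleLimit {θ₀ : ℝ} (hθ₀ : θ₀ ∉ AddSubgroup.zmultiples (Real.pi / 2))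
    (h : ∀ (G : Type) [Group G] [TopologicalSpace G] [IsTopologicalGroup G] [CompactSpace G],
      IsCompactSimpleLieGroup G → letI : MeasurableSpace G := borel G; haveI : BorelSpace G := ⟨rfl⟩;
      ∀ (r : LatticeRep G) (a : ℝ → ℝ), (∀ β, 0 < a β) → Tendsto a atTop (𝓝 0) → MomentBounds6 G r a →
        ∀ sch : SpeciesScheme (YMSpecies G), IsLegScheme a sch → ∃ r₀ : ℝ, 0 < r₀ ∧
          ∀ φ : ℕ → ℕ, Tendsto φ atTop atTop → ∀ S₁ : SchwingerFamily E4, OffDiagLimitAlong r sch φ S₁ →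
            ∀ (n : ℕ), 2 ≤ n → ∀ F ∈ King.KingClass n r₀, S₁ n (linActMulti (planeRot (0 : Fin 3) θ₀) F) = S₁ n F) :
    Summit.QuantumFields.YangMills.Theses.BalabanLadder.ROT := by
  refine rot_of_kingLimit (kingLimit_of_anyAngleLimit ?_)
  intro G _ _ _ _ hG
  letI : MeasurableSpace G := borel G
  haveI : BorelSpace G := ⟨rfl⟩
  intro r a hapos ha0 hMB sch hsch
  obtain ⟨r₀, hr₀, H⟩ := h G hG r a hapos ha0 hMB sch hsch
  exact ⟨r₀, hr₀, fun φ hφ S₁ hS₁ => ⟨θ₀, hθ₀, H φ hφ S₁ hS₁⟩⟩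

end Summit.QuantumFields.YangMills.Theorems.ROT.KingStabiliser

end
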